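import Literature.Geometry.Symplectic.ClosedOneFormLoopPeriods
import HarnessLib

/-!
# The orbit periods of a primitive of `ω` along a Hamiltonian circle action: `dA = d(r²/2)`

Topic `Literature/Geometry/Symplectic`; proofs file (layer "wrapping number on the tube") of the
fact seat of `Literature.Geometry.Symplectic.mclean_divisorComplement_convex_four` (M. McLean,
*The growth rate of symplectic homology and affine varieties*, GAFA 22 (2012), Lemma 5.17).
In McLean's tube of the divisor the rotation of the normal discs is the Hamiltonian flow of
`-r²/2` (`ι_X ω = -½ d(r²)`, p. 37: `X_{ν(r)} = -(ν'/r) ∂_ϑ`), and the period of a primitive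
`θ` of `ω` over the orbit through `x`, `2π A(x) = ∮_{orbit(x)} θ`, satisfies
`A = r²/2 + κ` with `κ` locally constant (the wrapping number; p. 36).  This file proves the
flat, chart-level form of **`dA = d(r²/2)`**: by the first variation formula
(`hasDerivAt_loopIntegral`) the derivative of the orbit period along a smooth one-parameter
family of orbits `Γ(t, s)` is the flux `∫ ω(∂ₛΓ, ∂ₜΓ) dt`; the moment-map identity
`ω(∂ₜΓ, w) = -½ dr(w)` along the orbits and the invariance of `r` turn the flux into
`π · d/ds r(Γ(0, s))` (`hasDerivAt_orbitPeriod`), so `∮θ - π r` is constant along the family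
(`hasDerivAt_orbitPeriod_sub`).  The last section restates everything for periodic (unrolled)
families with matching ends, the form used in flat slice models of circle actions.

Everything is proved; no definitions, no named facts (D-0026).

## References

* M. McLean, *The growth rate of symplectic homology and affine varieties*, Geom. Funct. Anal. 22
  (2012), pp. 36–37. [Mclean2012]
* D. McDuff, D. Salamon, *Introduction to Symplectic Topology*, 3rd ed. (2017), §5.5
  (Hamiltonian circle actions). [McDuffSalamon2017]
-/

noncomputable section

open scoped Topology ContDiff Real
open Set Filter ContinuousAlternatingMap MeasureTheory intervalIntegral

namespace Literature.Geometry.Symplectic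

variable {E : Type*} [NormedAddCommGroup E] [NormedSpace ℝ E]
  {β : E → E [⋀^Fin 1]→L[ℝ] ℝ} {Om : E → E [⋀^Fin 2]→L[ℝ] ℝ} {O : Set E} {Γ : ℝ × ℝ → E}
  {r : E → ℝ}

/-- **First variation of the orbit period under a Hamiltonian circle action** (flat form).
Let `β` be a `C^∞` `1`-form on an open `O ⊆ E` with `dβ = ω` there, `Γ : ℝ × ℝ → O` a `C^∞`
family of `2π`-loops in `t` (`Γ(0, s) = Γ(2π, s)`), `r` differentiable with `r(Γ(t, s))`
independent of `t`, and suppose the moment-map identity `ω_{Γ}(∂ₜΓ, w) = -½ dr_{Γ}(w)` along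
the family.  Then `d/ds ∮_{Γ(·,s)} β = π · d/ds r(Γ(0, s))` (McLean 2012, pp. 36–37: the orbit
period of `θ` is `2π(r²/2 + κ)`). [cite: Mclean2012, Lemma 5.17 (proof)] -/
theorem hasDerivAt_orbitPeriod (hO : IsOpen O) (hβ : ContDiffOn ℝ ∞ β O)
    (hd : ∀ y ∈ O, extDeriv β y = Om y) (hΓ : ContDiff ℝ ∞ Γ) (hΓO : ∀ q, Γ q ∈ O)
    (hloop : ∀ s, Γ (0, s) = Γ (2 * π, s)) (hr : Differentiable ℝ r)
    (hinv : ∀ t s, r (Γ (t, s)) = r (Γ (0, s)))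
    (hmoment : ∀ q (w : E),
      Om (Γ q) ![fderiv ℝ Γ q (1, 0), w] = -(1 / 2) * fderiv ℝ r (Γ q) w) (s₀ : ℝ) :
    HasDerivAt (fun s ↦ ∫ t in (0 : ℝ)..2 * π, β (Γ (t, s)) ![fderiv ℝ Γ (t, s) (1, 0)])
      (π * deriv (fun s ↦ r (Γ (0, s))) s₀) s₀ := by
  have h1 := hasDerivAt_loopIntegral (a := 0) (b := 2 * π) hO hβ hΓ hΓO hloop s₀
  -- the flux integrand is the constant `½ d/ds r(Γ(0, s))`
  set D : ℝ := deriv (fun s ↦ r (Γ (0, s))) s₀ with hD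
  have hpt : ∀ t, extDeriv β (Γ (t, s₀)) ![fderiv ℝ Γ (t, s₀) (0, 1), fderiv ℝ Γ (t, s₀) (1, 0)] =
      (1 / 2) * D := by
    intro t
    rw [hd _ (hΓO _)]
    -- antisymmetry
    have hswap : Om (Γ (t, s₀)) ![fderiv ℝ Γ (t, s₀) (0, 1), fderiv ℝ Γ (t, s₀) (1, 0)] =
        -Om (Γ (t, s₀)) ![fderiv ℝ Γ (t, s₀) (1, 0), fderiv ℝ Γ (t, s₀) (0, 1)] := by
      have h := (Om (Γ (t, s₀))).map_swap ![fderiv ℝ Γ (t, s₀) (1, 0), fderiv ℝ Γ (t, s₀) (0, 1)]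
        (i := 0) (j := 1) (by decide)
      have hsw : ((![fderiv ℝ Γ (t, s₀) (1, 0), fderiv ℝ Γ (t, s₀) (0, 1)] : Fin 2 → E) ∘
          Equiv.swap (0 : Fin 2) 1) =
          ![fderiv ℝ Γ (t, s₀) (0, 1), fderiv ℝ Γ (t, s₀) (1, 0)] := by
        funext i
        fin_cases i <;> rfl
      rw [hsw] at h
      exact h
    rw [hswap, hmoment]
    -- chain rule: `dr(∂ₛΓ) = ∂ₛ (r ∘ Γ)`, and invariance in `t`
    have hchain : fderiv ℝ r (Γ (t, s₀)) (fderiv ℝ Γ (t, s₀) (0, 1)) =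
        deriv (fun s ↦ r (Γ (t, s))) s₀ := by
      have h2 : HasDerivAt (fun s : ℝ ↦ ((t, s) : ℝ × ℝ)) ((0 : ℝ), (1 : ℝ)) s₀ := by
        simpa using (hasDerivAt_const s₀ t).prodMk (hasDerivAt_id s₀)
      have h3 : HasDerivAt (fun s ↦ Γ (t, s)) (fderiv ℝ Γ (t, s₀) (0, 1)) s₀ :=
        ((hΓ.differentiable (by simp)) (t, s₀)).hasFDerivAt.comp_hasDerivAt s₀ h2
      have h4 : HasDerivAt (fun s ↦ r (Γ (t, s)))
          (fderiv ℝ r (Γ (t, s₀)) (fderiv ℝ Γ (t, s₀) (0, 1))) s₀ :=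
        (hr (Γ (t, s₀))).hasFDerivAt.comp_hasDerivAt s₀ h3
      exact h4.deriv.symm
    have hfun : (fun s ↦ r (Γ (t, s))) = fun s ↦ r (Γ (0, s)) := funext fun s ↦ hinv t s
    rw [hchain, hfun, ← hD]
    ring
  have hint : ∫ t in (0 : ℝ)..2 * π,
      extDeriv β (Γ (t, s₀)) ![fderiv ℝ Γ (t, s₀) (0, 1), fderiv ℝ Γ (t, s₀) (1, 0)] = π * D := by
    simp_rw [hpt]
    rw [intervalIntegral.integral_const, sub_zero, smul_eq_mul]
    ring
  rwa [hint] at h1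

/-- **`∮_{orbit} θ - π r` is constant along a smooth family of orbits** of a Hamiltonian circle
action with `ι_X ω = -½ dr` (McLean 2012, pp. 36–37: `A - r²/2 = κ`, the wrapping number,
with `2π A = ∮ θ`, `r = r²`). [cite: Mclean2012, Lemma 5.17 (proof)] -/
theorem hasDerivAt_orbitPeriod_sub (hO : IsOpen O) (hβ : ContDiffOn ℝ ∞ β O)
    (hd : ∀ y ∈ O, extDeriv β y = Om y) (hΓ : ContDiff ℝ ∞ Γ) (hΓO : ∀ q, Γ q ∈ O)
    (hloop : ∀ s, Γ (0, s) = Γ (2 * π, s)) (hr : Differentiable ℝ r)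
    (hinv : ∀ t s, r (Γ (t, s)) = r (Γ (0, s)))
    (hmoment : ∀ q (w : E),
      Om (Γ q) ![fderiv ℝ Γ q (1, 0), w] = -(1 / 2) * fderiv ℝ r (Γ q) w) (s₀ : ℝ) :
    HasDerivAt (fun s ↦ (∫ t in (0 : ℝ)..2 * π, β (Γ (t, s)) ![fderiv ℝ Γ (t, s) (1, 0)]) -
      π * r (Γ (0, s))) 0 s₀ := by
  have h1 := hasDerivAt_orbitPeriod hO hβ hd hΓ hΓO hloop hr hinv hmoment s₀
  have h2 : HasDerivAt (fun s ↦ π * r (Γ (0, s))) (π * deriv (fun s ↦ r (Γ (0, s))) s₀) s₀ := by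
    have h3 : HasDerivAt (fun s : ℝ ↦ ((0, s) : ℝ × ℝ)) ((0 : ℝ), (1 : ℝ)) s₀ := by
      simpa using (hasDerivAt_const s₀ (0 : ℝ)).prodMk (hasDerivAt_id s₀)
    have h4 : HasDerivAt (fun s ↦ r (Γ (0, s)))
        (fderiv ℝ r (Γ (0, s₀)) (fderiv ℝ Γ (0, s₀) (0, 1))) s₀ :=
      (hr (Γ (0, s₀))).hasFDerivAt.comp_hasDerivAt s₀
        (((hΓ.differentiable (by simp)) (0, s₀)).hasFDerivAt.comp_hasDerivAt s₀ h3)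
    rw [h4.deriv]
    exact h4.const_mul π
  have h := h1.sub h2
  rwa [sub_self] at h

/-- **The orbit period minus `π r` is the same for all orbits of a smooth family** (integrated
form: a function with zero derivative everywhere is constant).
[cite: Mclean2012, Lemma 5.17 (proof)] -/
theorem orbitPeriod_sub_eq (hO : IsOpen O) (hβ : ContDiffOn ℝ ∞ β O)
    (hd : ∀ y ∈ O, extDeriv β y = Om y) (hΓ : ContDiff ℝ ∞ Γ) (hΓO : ∀ q, Γ q ∈ O)
    (hloop : ∀ s, Γ (0, s) = Γ (2 * π, s)) (hr : Differentiable ℝ r)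
    (hinv : ∀ t s, r (Γ (t, s)) = r (Γ (0, s)))
    (hmoment : ∀ q (w : E),
      Om (Γ q) ![fderiv ℝ Γ q (1, 0), w] = -(1 / 2) * fderiv ℝ r (Γ q) w) (s₁ s₂ : ℝ) :
    (∫ t in (0 : ℝ)..2 * π, β (Γ (t, s₁)) ![fderiv ℝ Γ (t, s₁) (1, 0)]) - π * r (Γ (0, s₁)) =
      (∫ t in (0 : ℝ)..2 * π, β (Γ (t, s₂)) ![fderiv ℝ Γ (t, s₂) (1, 0)]) - π * r (Γ (0, s₂)) := by
  have hD := fun s ↦ hasDerivAt_orbitPeriod_sub hO hβ hd hΓ hΓO hloop hr hinv hmoment s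
  exact is_const_of_deriv_eq_zero (fun s ↦ (hD s).differentiableAt) (fun s ↦ (hD s).deriv) s₁ s₂

/-! ### Periodic families (unrolled orbits)

The same statements with the closed-loop hypothesis `Γ(0, s) = Γ(2π, s)` replaced by matching
ends (`β(Γ(2π, s)) = β(Γ(0, s))`, `∂ₛΓ(2π, s) = ∂ₛΓ(0, s)`): the form in which they are used for
the straight orbits `t ↦ (u, t)` of a circle action in a flat slice model `dom × ℝ`, where the
pulled-back forms are `2π`-periodic in `t`. -/

/-- `hasDerivAt_orbitPeriod` for periodic (unrolled) families.
[cite: Mclean2012, Lemma 5.17 (proof)] -/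
theorem hasDerivAt_orbitPeriod_of_ends (hO : IsOpen O) (hβ : ContDiffOn ℝ ∞ β O)
    (hd : ∀ y ∈ O, extDeriv β y = Om y) (hΓ : ContDiff ℝ ∞ Γ) (hΓO : ∀ q, Γ q ∈ O)
    (hends : ∀ s, β (Γ (2 * π, s)) = β (Γ (0, s)))
    (hends' : ∀ s, fderiv ℝ Γ (2 * π, s) (0, 1) = fderiv ℝ Γ (0, s) (0, 1))
    (hr : ∀ q, DifferentiableAt ℝ r (Γ q)) (hinv : ∀ t s, r (Γ (t, s)) = r (Γ (0, s)))
    (hmoment : ∀ q (w : E),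
      Om (Γ q) ![fderiv ℝ Γ q (1, 0), w] = -(1 / 2) * fderiv ℝ r (Γ q) w) (s₀ : ℝ) :
    HasDerivAt (fun s ↦ ∫ t in (0 : ℝ)..2 * π, β (Γ (t, s)) ![fderiv ℝ Γ (t, s) (1, 0)])
      (π * deriv (fun s ↦ r (Γ (0, s))) s₀) s₀ := by
  have h1 := hasDerivAt_loopIntegral_of_ends (a := 0) (b := 2 * π) hO hβ hΓ hΓO hends hends' s₀
  set D : ℝ := deriv (fun s ↦ r (Γ (0, s))) s₀ with hD
  have hpt : ∀ t, extDeriv β (Γ (t, s₀)) ![fderiv ℝ Γ (t, s₀) (0, 1), fderiv ℝ Γ (t, s₀) (1, 0)] =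
      (1 / 2) * D := by
    intro t
    rw [hd _ (hΓO _)]
    have hswap : Om (Γ (t, s₀)) ![fderiv ℝ Γ (t, s₀) (0, 1), fderiv ℝ Γ (t, s₀) (1, 0)] =
        -Om (Γ (t, s₀)) ![fderiv ℝ Γ (t, s₀) (1, 0), fderiv ℝ Γ (t, s₀) (0, 1)] := by
      have h := (Om (Γ (t, s₀))).map_swap ![fderiv ℝ Γ (t, s₀) (1, 0), fderiv ℝ Γ (t, s₀) (0, 1)]
        (i := 0) (j := 1) (by decide)
      have hsw : ((![fderiv ℝ Γ (t, s₀) (1, 0), fderiv ℝ Γ (t, s₀) (0, 1)] : Fin 2 → E) ∘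
          Equiv.swap (0 : Fin 2) 1) =
          ![fderiv ℝ Γ (t, s₀) (0, 1), fderiv ℝ Γ (t, s₀) (1, 0)] := by
        funext i
        fin_cases i <;> rfl
      rw [hsw] at h
      exact h
    rw [hswap, hmoment]
    have hchain : fderiv ℝ r (Γ (t, s₀)) (fderiv ℝ Γ (t, s₀) (0, 1)) =
        deriv (fun s ↦ r (Γ (t, s))) s₀ := by
      have h2 : HasDerivAt (fun s : ℝ ↦ ((t, s) : ℝ × ℝ)) ((0 : ℝ), (1 : ℝ)) s₀ := by
        simpa using (hasDerivAt_const s₀ t).prodMk (hasDerivAt_id s₀)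
      have h3 : HasDerivAt (fun s ↦ Γ (t, s)) (fderiv ℝ Γ (t, s₀) (0, 1)) s₀ :=
        ((hΓ.differentiable (by simp)) (t, s₀)).hasFDerivAt.comp_hasDerivAt s₀ h2
      have h4 : HasDerivAt (fun s ↦ r (Γ (t, s)))
          (fderiv ℝ r (Γ (t, s₀)) (fderiv ℝ Γ (t, s₀) (0, 1))) s₀ :=
        (hr (t, s₀)).hasFDerivAt.comp_hasDerivAt s₀ h3
      exact h4.deriv.symm
    have hfun : (fun s ↦ r (Γ (t, s))) = fun s ↦ r (Γ (0, s)) := funext fun s ↦ hinv t s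
    rw [hchain, hfun, ← hD]
    ring
  have hint : ∫ t in (0 : ℝ)..2 * π,
      extDeriv β (Γ (t, s₀)) ![fderiv ℝ Γ (t, s₀) (0, 1), fderiv ℝ Γ (t, s₀) (1, 0)] = π * D := by
    simp_rw [hpt]
    rw [intervalIntegral.integral_const, sub_zero, smul_eq_mul]
    ring
  rwa [hint] at h1

/-- `hasDerivAt_orbitPeriod_sub` for periodic (unrolled) families.
[cite: Mclean2012, Lemma 5.17 (proof)] -/
theorem hasDerivAt_orbitPeriod_sub_of_ends (hO : IsOpen O) (hβ : ContDiffOn ℝ ∞ β O)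
    (hd : ∀ y ∈ O, extDeriv β y = Om y) (hΓ : ContDiff ℝ ∞ Γ) (hΓO : ∀ q, Γ q ∈ O)
    (hends : ∀ s, β (Γ (2 * π, s)) = β (Γ (0, s)))
    (hends' : ∀ s, fderiv ℝ Γ (2 * π, s) (0, 1) = fderiv ℝ Γ (0, s) (0, 1))
    (hr : ∀ q, DifferentiableAt ℝ r (Γ q)) (hinv : ∀ t s, r (Γ (t, s)) = r (Γ (0, s)))
    (hmoment : ∀ q (w : E),
      Om (Γ q) ![fderiv ℝ Γ q (1, 0), w] = -(1 / 2) * fderiv ℝ r (Γ q) w) (s₀ : ℝ) :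
    HasDerivAt (fun s ↦ (∫ t in (0 : ℝ)..2 * π, β (Γ (t, s)) ![fderiv ℝ Γ (t, s) (1, 0)]) -
      π * r (Γ (0, s))) 0 s₀ := by
  have h1 := hasDerivAt_orbitPeriod_of_ends hO hβ hd hΓ hΓO hends hends' hr hinv hmoment s₀
  have h2 : HasDerivAt (fun s ↦ π * r (Γ (0, s))) (π * deriv (fun s ↦ r (Γ (0, s))) s₀) s₀ := by
    have h3 : HasDerivAt (fun s : ℝ ↦ ((0, s) : ℝ × ℝ)) ((0 : ℝ), (1 : ℝ)) s₀ := by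
      simpa using (hasDerivAt_const s₀ (0 : ℝ)).prodMk (hasDerivAt_id s₀)
    have h4 : HasDerivAt (fun s ↦ r (Γ (0, s)))
        (fderiv ℝ r (Γ (0, s₀)) (fderiv ℝ Γ (0, s₀) (0, 1))) s₀ :=
      (hr (0, s₀)).hasFDerivAt.comp_hasDerivAt s₀
        (((hΓ.differentiable (by simp)) (0, s₀)).hasFDerivAt.comp_hasDerivAt s₀ h3)
    rw [h4.deriv]
    exact h4.const_mul π
  have h := h1.sub h2
  rwa [sub_self] at h

/-- `orbitPeriod_sub_eq` for periodic (unrolled) families: `∮β - π r` is the same for all the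
orbits of the family. [cite: Mclean2012, Lemma 5.17 (proof)] -/
theorem orbitPeriod_sub_eq_of_ends (hO : IsOpen O) (hβ : ContDiffOn ℝ ∞ β O)
    (hd : ∀ y ∈ O, extDeriv β y = Om y) (hΓ : ContDiff ℝ ∞ Γ) (hΓO : ∀ q, Γ q ∈ O)
    (hends : ∀ s, β (Γ (2 * π, s)) = β (Γ (0, s)))
    (hends' : ∀ s, fderiv ℝ Γ (2 * π, s) (0, 1) = fderiv ℝ Γ (0, s) (0, 1))
    (hr : ∀ q, DifferentiableAt ℝ r (Γ q)) (hinv : ∀ t s, r (Γ (t, s)) = r (Γ (0, s)))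
    (hmoment : ∀ q (w : E),
      Om (Γ q) ![fderiv ℝ Γ q (1, 0), w] = -(1 / 2) * fderiv ℝ r (Γ q) w) (s₁ s₂ : ℝ) :
    (∫ t in (0 : ℝ)..2 * π, β (Γ (t, s₁)) ![fderiv ℝ Γ (t, s₁) (1, 0)]) - π * r (Γ (0, s₁)) =
      (∫ t in (0 : ℝ)..2 * π, β (Γ (t, s₂)) ![fderiv ℝ Γ (t, s₂) (1, 0)]) - π * r (Γ (0, s₂)) := by
  have hD := fun s ↦
    hasDerivAt_orbitPeriod_sub_of_ends hO hβ hd hΓ hΓO hends hends' hr hinv hmoment s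
  exact is_const_of_deriv_eq_zero (fun s ↦ (hD s).differentiableAt) (fun s ↦ (hD s).deriv) s₁ s₂

end Literature.Geometry.Symplectic
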